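import Summits.NavierStokesRegularity.NavierStokesRegularity.Theses.RellichScar
import HarnessLib

/-!
# drefute gift: a sorry-free proof of stub `stub_twinNorms` (S2) of line finite-energy-log-convexity

Statement verbatim from `Cruxes/ScarRigidity/Lines/finite-energy-log-convexity.lean` (lead skeleton 2026-08-16T00:17Z).
Route: one pointwise majorant `16(C+K)(−t)/(‖x‖+√−t)³` (`majorant`), a generic radial-majorant `L^p` bound
(`eLpNorm_le_of_radial_majorant`: `‖f‖_p ≤ A a^{3/p−k} I_{kp}^{1/p}` by the Haar scaling `x = a • y`,
`Measure.map_addHaar_smul`, and `finite_integral_one_add_norm`), instantiated at `(k,p) = (3,2), (3,6/5), (2,2)`.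
-/

noncomputable section

open Set Filter Function MeasureTheory Metric TopologicalSpace Module
open scoped Topology ENNReal NNReal
open Literature.Analysis.FluidPDE

namespace Refuter.Drefute.FELC.S2

/-- Physical space. -/
local notation "ℝ³" => EuclideanSpace ℝ (Fin 3)

theorem finrank_R3 : finrank ℝ ℝ³ = 3 := by simp

/-- The Japanese-bracket integral `I_r = ∫ (1+‖y‖)^{-r} dy` on `ℝ³`. -/
def Ibr (r : ℝ) : ℝ≥0∞ := ∫⁻ y : ℝ³, ENNReal.ofReal ((1 + ‖y‖) ^ (-r))

theorem Ibr_lt_top {r : ℝ} (hr : 3 < r) : Ibr r < ∞ := by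
  unfold Ibr
  have h : (finrank ℝ ℝ³ : ℝ) < r := by rw [finrank_R3]; exact_mod_cast hr
  exact finite_integral_one_add_norm h

/-- SCALING: `∫ (‖x‖+a)^{-r} dx = a^{3-r} I_r` for `a > 0`. -/
theorem lintegral_norm_add_rpow_neg {a r : ℝ} (ha : 0 < a) :
    ∫⁻ x : ℝ³, ENNReal.ofReal ((‖x‖ + a) ^ (-r)) = ENNReal.ofReal (a ^ (3 - r)) * Ibr r := by
  have key : ∀ x : ℝ³, (‖x‖ + a) ^ (-r) = a ^ (-r) * (1 + ‖a⁻¹ • x‖) ^ (-r) := by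
    intro x
    rw [norm_smul, norm_inv, Real.norm_of_nonneg ha.le, ← Real.mul_rpow ha.le (by positivity)]
    congr 1
    field_simp
    ring
  simp_rw [key]
  have hsplit : ∀ x : ℝ³, ENNReal.ofReal (a ^ (-r) * (1 + ‖a⁻¹ • x‖) ^ (-r)) =
      ENNReal.ofReal (a ^ (-r)) * ENNReal.ofReal ((1 + ‖a⁻¹ • x‖) ^ (-r)) := fun x =>
    ENNReal.ofReal_mul (Real.rpow_nonneg ha.le _)
  simp_rw [hsplit]
  rw [lintegral_const_mul' _ _ ENNReal.ofReal_ne_top]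
  -- change of variables `y = a⁻¹ • x`
  have hainv : a⁻¹ ≠ 0 := inv_ne_zero ha.ne'
  set e : ℝ³ ≃ᵐ ℝ³ := (Homeomorph.smul (isUnit_iff_ne_zero.2 hainv).unit).toMeasurableEquiv with he
  have hcov : ∫⁻ x : ℝ³, ENNReal.ofReal ((1 + ‖a⁻¹ • x‖) ^ (-r)) =
      ENNReal.ofReal (a ^ (3 : ℝ)) * Ibr r := by
    have h1 : ∫⁻ x : ℝ³, ENNReal.ofReal ((1 + ‖a⁻¹ • x‖) ^ (-r)) =
        ∫⁻ y, ENNReal.ofReal ((1 + ‖y‖) ^ (-r)) ∂(Measure.map e volume) := by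
      rw [lintegral_map_equiv]
      rfl
    rw [h1]
    have h2 : Measure.map e volume = ENNReal.ofReal (abs ((a⁻¹) ^ finrank ℝ ℝ³)⁻¹) • (volume : Measure ℝ³) := by
      have := Measure.map_addHaar_smul (volume : Measure ℝ³) hainv
      exact this
    rw [h2, lintegral_smul_measure, finrank_R3]
    congr 1
    rw [inv_pow, inv_inv, abs_of_pos (pow_pos ha 3)]
    norm_cast
  rw [hcov, ← mul_assoc, ← ENNReal.ofReal_mul (Real.rpow_nonneg ha.le _)]
  congr 2
  rw [← Real.rpow_add ha]
  ring_nf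

/-- GENERIC RADIAL-MAJORANT BOUND: if `‖f x‖ ≤ A (‖x‖+a)^{-k}` with `a > 0`, `A ≥ 0`, `p ≥ 1`, `k p > 3`,
then `‖f‖_{L^p} ≤ A · a^{3/p-k} · I_{kp}^{1/p}`. -/
theorem eLpNorm_le_of_radial_majorant {F : Type*} [NormedAddCommGroup F] {f : ℝ³ → F}
    {A a k p : ℝ} (ha : 0 < a) (hA : 0 ≤ A) (hp : 1 ≤ p) (hkp : 3 < k * p)
    (hf : ∀ x, ‖f x‖ ≤ A * (‖x‖ + a) ^ (-k)) :
    eLpNorm f (ENNReal.ofReal p) volume ≤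
      ENNReal.ofReal (A * a ^ (3 / p - k) * ((Ibr (k * p)) ^ (1 / p)).toReal) := by
  have hp0 : 0 < p := by linarith
  have hpne : ENNReal.ofReal p ≠ 0 := (ENNReal.ofReal_pos.2 hp0).ne'
  have hptop : ENNReal.ofReal p ≠ ∞ := ENNReal.ofReal_ne_top
  rw [eLpNorm_eq_lintegral_rpow_enorm_toReal hpne hptop, ENNReal.toReal_ofReal hp0.le]
  -- pointwise bound on `‖f x‖ₑ ^ p`
  have hpt : ∀ x, ‖f x‖ₑ ^ p ≤
      ENNReal.ofReal (A ^ p) * ENNReal.ofReal ((‖x‖ + a) ^ (-(k * p))) := by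
    intro x
    have h0 : 0 ≤ (‖x‖ + a) ^ (-k) := Real.rpow_nonneg (by positivity) _
    calc ‖f x‖ₑ ^ p = ENNReal.ofReal ‖f x‖ ^ p := by rw [ofReal_norm]
      _ ≤ ENNReal.ofReal (A * (‖x‖ + a) ^ (-k)) ^ p := by
          gcongr
          exact hf x
      _ = ENNReal.ofReal ((A * (‖x‖ + a) ^ (-k)) ^ p) := by
          rw [ENNReal.ofReal_rpow_of_nonneg (by positivity) hp0.le]
      _ = ENNReal.ofReal (A ^ p * (‖x‖ + a) ^ (-(k * p))) := by
          rw [Real.mul_rpow hA h0, ← Real.rpow_mul (by positivity)]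
          ring_nf
      _ = _ := ENNReal.ofReal_mul (Real.rpow_nonneg hA _)
  have hint : ∫⁻ x, ‖f x‖ₑ ^ p ∂(volume : Measure ℝ³) ≤
      ENNReal.ofReal (A ^ p) * (ENNReal.ofReal (a ^ (3 - k * p)) * Ibr (k * p)) := by
    calc ∫⁻ x, ‖f x‖ₑ ^ p ∂volume
          ≤ ∫⁻ x, ENNReal.ofReal (A ^ p) * ENNReal.ofReal ((‖x‖ + a) ^ (-(k * p))) ∂volume :=
          lintegral_mono hpt
      _ = ENNReal.ofReal (A ^ p) * ∫⁻ x : ℝ³, ENNReal.ofReal ((‖x‖ + a) ^ (-(k * p))) := by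
          rw [lintegral_const_mul' _ _ ENNReal.ofReal_ne_top]
      _ = _ := by rw [lintegral_norm_add_rpow_neg ha]
  -- take `p`-th roots
  have hI : Ibr (k * p) ≠ ∞ := (Ibr_lt_top hkp).ne
  calc (∫⁻ x, ‖f x‖ₑ ^ p ∂volume) ^ (1 / p)
        ≤ (ENNReal.ofReal (A ^ p) * (ENNReal.ofReal (a ^ (3 - k * p)) * Ibr (k * p))) ^ (1 / p) := by
          gcongr
      _ = ENNReal.ofReal (A * a ^ (3 / p - k) * ((Ibr (k * p)) ^ (1 / p)).toReal) := by
          rw [ENNReal.mul_rpow_of_nonneg _ _ (by positivity),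
            ENNReal.mul_rpow_of_nonneg _ _ (by positivity),
            ENNReal.ofReal_rpow_of_nonneg (by positivity) (by positivity),
            ENNReal.ofReal_rpow_of_nonneg (by positivity) (by positivity),
            ← Real.rpow_mul hA, ← Real.rpow_mul ha.le]
          have e1 : p * (1 / p) = 1 := by field_simp
          have e2 : (3 - k * p) * (1 / p) = 3 / p - k := by field_simp
          rw [e1, Real.rpow_one, e2,
            ENNReal.ofReal_mul (by positivity : 0 ≤ A * a ^ (3 / p - k)), ENNReal.ofReal_mul hA,
            ENNReal.ofReal_toReal (ENNReal.rpow_ne_top_of_nonneg (by positivity) hI), mul_assoc]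

/-- Division by a cube as a real power. -/
theorem div_pow_three_eq_mul_rpow {A b : ℝ} (hb : 0 < b) : A / b ^ 3 = A * b ^ (-(3 : ℝ)) := by
  rw [Real.rpow_neg hb.le, div_eq_mul_inv]
  norm_cast

/-- Division by a square as a real power. -/
theorem div_pow_two_eq_mul_rpow {A b : ℝ} (hb : 0 < b) : A / b ^ 2 = A * b ^ (-(2 : ℝ)) := by
  rw [Real.rpow_neg hb.le, div_eq_mul_inv]
  norm_cast

/-- STEP 1 — the single pointwise majorant `16(C+K)(−t)/(‖x‖+√−t)³`. -/
theorem majorant {V₁ V₂ : ℝ → ℝ³ → ℝ³} {C K : ℝ} (hC : 0 ≤ C) (hK : 0 ≤ K)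
    (hd₁ : HasTypeIDecay C V₁) (hd₂ : HasTypeIDecay C V₂)
    (hfar : ∀ t < 0, ∀ x : ℝ³, x ≠ 0 → ‖V₁ t x - V₂ t x‖ ≤ K * (-t) / ‖x‖ ^ 3)
    {t : ℝ} (ht : t < 0) (x : ℝ³) :
    ‖V₁ t x - V₂ t x‖ ≤ 16 * (C + K) * (-t) / (‖x‖ + Real.sqrt (-t)) ^ 3 := by
  set a := Real.sqrt (-t) with ha
  have ha0 : 0 < a := Real.sqrt_pos.2 (by linarith)
  have ha2 : a ^ 2 = -t := Real.sq_sqrt (by linarith)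
  have hxa : 0 < ‖x‖ + a := by positivity
  rw [le_div_iff₀ (pow_pos hxa 3)]
  set w := ‖V₁ t x - V₂ t x‖ with hw
  have hw0 : 0 ≤ w := norm_nonneg _
  rcases le_total ‖x‖ a with hle | hle
  · -- parabolic core: `w ≤ 2C/(‖x‖+a)`
    have h1 : w ≤ 2 * C / (‖x‖ + a) := by
      calc w ≤ ‖V₁ t x‖ + ‖V₂ t x‖ := norm_sub_le _ _
        _ ≤ C / (‖x‖ + a) + C / (‖x‖ + a) := add_le_add (hd₁ t ht x) (hd₂ t ht x)
        _ = 2 * C / (‖x‖ + a) := by ring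
    have h2 : w * (‖x‖ + a) ≤ 2 * C := (le_div_iff₀ hxa).1 h1
    have h3 : (‖x‖ + a) ^ 2 ≤ (2 * a) ^ 2 := pow_le_pow_left₀ hxa.le (by linarith) 2
    calc w * (‖x‖ + a) ^ 3 = (w * (‖x‖ + a)) * (‖x‖ + a) ^ 2 := by ring
      _ ≤ 2 * C * (2 * a) ^ 2 := mul_le_mul h2 h3 (by positivity) (by positivity)
      _ = 8 * C * (-t) := by rw [mul_pow, ha2]; ring
      _ ≤ 16 * (C + K) * (-t) := by nlinarith
  · -- exterior: `w ≤ K(−t)/‖x‖³`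
    have hx0 : x ≠ 0 := by
      intro h; rw [h, norm_zero] at hle; linarith
    have hxn : 0 < ‖x‖ := norm_pos_iff.2 hx0
    have h2 : w * ‖x‖ ^ 3 ≤ K * (-t) := (le_div_iff₀ (pow_pos hxn 3)).1 (hfar t ht x hx0)
    have h3 : (‖x‖ + a) ^ 3 ≤ (2 * ‖x‖) ^ 3 := pow_le_pow_left₀ hxa.le (by linarith) 3
    calc w * (‖x‖ + a) ^ 3 ≤ w * (2 * ‖x‖) ^ 3 := mul_le_mul_of_nonneg_left h3 hw0
      _ = 8 * (w * ‖x‖ ^ 3) := by ring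
      _ ≤ 8 * (K * (-t)) := by nlinarith
      _ ≤ 16 * (C + K) * (-t) := by nlinarith

/-- The unit vector `e₀` of `ℝ³` has norm one. -/
theorem norm_single_one : ‖(EuclideanSpace.single (0 : Fin 3) (1 : ℝ) : ℝ³)‖ = 1 := by
  simp

/-- **S2, proved** (statement verbatim from the lead's skeleton). -/
theorem stub_twinNorms :
    ∀ (V₁ V₂ : ℝ → ℝ³ → ℝ³) (C L₁ L₂ K : ℝ), HasTypeIDecay C V₁ → HasTypeIDecay C V₂ →
      (∀ t < 0, ∀ x : ℝ³, ‖fderiv ℝ (V₁ t) x‖ ≤ L₁ / (‖x‖ + Real.sqrt (-t)) ^ 2) →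
      (∀ t < 0, ∀ x : ℝ³, ‖fderiv ℝ (V₂ t) x‖ ≤ L₂ / (‖x‖ + Real.sqrt (-t)) ^ 2) →
      (∀ t < 0, ∀ x : ℝ³, x ≠ 0 → ‖V₁ t x - V₂ t x‖ ≤ K * (-t) / ‖x‖ ^ 3) →
      ∃ K' : ℝ, 0 ≤ K' ∧ ∀ t < 0,
        (∀ x : ℝ³, ‖V₁ t x - V₂ t x‖ ≤ K' * (-t) / (‖x‖ + Real.sqrt (-t)) ^ 3) ∧
        eLpNorm (fun x => V₁ t x - V₂ t x) 2 volume ≤ ENNReal.ofReal (K' * (-t) ^ ((1 : ℝ) / 4)) ∧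
        eLpNorm (fun x => V₁ t x - V₂ t x) ((6 : ℝ≥0∞) / 5) volume ≤
          ENNReal.ofReal (K' * (-t) ^ ((3 : ℝ) / 4)) ∧
        eLpNorm (fun x => fderiv ℝ (V₁ t) x - fderiv ℝ (V₂ t) x) 2 volume ≤
          ENNReal.ofReal (K' * (-t) ^ (-(1 : ℝ) / 4)) := by
  intro V₁ V₂ C L₁ L₂ K hd₁ hd₂ hg₁ hg₂ hfar
  -- the constants are nonnegative (test the hypotheses at `t = -1`)
  have hm1 : (-1 : ℝ) < 0 := by norm_num
  have hsq1 : Real.sqrt (-(-1 : ℝ)) = 1 := by norm_num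
  have hC : 0 ≤ C := by
    have h := hd₁ (-1) hm1 0
    rw [norm_zero, hsq1, zero_add, div_one] at h
    exact (norm_nonneg _).trans h
  have hL₁ : 0 ≤ L₁ := by
    have h := hg₁ (-1) hm1 0
    rw [norm_zero, hsq1, zero_add, one_pow, div_one] at h
    exact (norm_nonneg _).trans h
  have hL₂ : 0 ≤ L₂ := by
    have h := hg₂ (-1) hm1 0
    rw [norm_zero, hsq1, zero_add, one_pow, div_one] at h
    exact (norm_nonneg _).trans h
  have hK : 0 ≤ K := by
    set e : ℝ³ := EuclideanSpace.single (0 : Fin 3) (1 : ℝ) with he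
    have hne : e ≠ 0 := by
      intro h0
      have := norm_single_one
      rw [← he, h0, norm_zero] at this
      exact zero_ne_one this
    have h := hfar (-1) hm1 e hne
    rw [norm_single_one, one_pow, div_one, neg_neg, mul_one] at h
    exact (norm_nonneg _).trans h
  -- constants from the three radial integrals
  set K₀ : ℝ := 16 * (C + K) with hK₀
  have hK₀0 : 0 ≤ K₀ := by positivity
  set c₂ : ℝ := ((Ibr (3 * 2)) ^ (1 / (2 : ℝ))).toReal with hc₂
  set c₃ : ℝ := ((Ibr (3 * (6 / 5))) ^ (1 / (6 / 5 : ℝ))).toReal with hc₃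
  set c₄ : ℝ := ((Ibr (2 * 2)) ^ (1 / (2 : ℝ))).toReal with hc₄
  have hc₂0 : 0 ≤ c₂ := ENNReal.toReal_nonneg
  have hc₃0 : 0 ≤ c₃ := ENNReal.toReal_nonneg
  have hc₄0 : 0 ≤ c₄ := ENNReal.toReal_nonneg
  set K' : ℝ := K₀ + K₀ * c₂ + K₀ * c₃ + (L₁ + L₂) * c₄ with hK'
  have hK'1 : K₀ ≤ K' := by rw [hK']; nlinarith [mul_nonneg hK₀0 hc₂0, mul_nonneg hK₀0 hc₃0, mul_nonneg (add_nonneg hL₁ hL₂) hc₄0]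
  have hK'2 : K₀ * c₂ ≤ K' := by rw [hK']; nlinarith [mul_nonneg hK₀0 hc₃0, mul_nonneg (add_nonneg hL₁ hL₂) hc₄0]
  have hK'3 : K₀ * c₃ ≤ K' := by rw [hK']; nlinarith [mul_nonneg hK₀0 hc₂0, mul_nonneg (add_nonneg hL₁ hL₂) hc₄0]
  have hK'4 : (L₁ + L₂) * c₄ ≤ K' := by rw [hK']; nlinarith [mul_nonneg hK₀0 hc₂0, mul_nonneg hK₀0 hc₃0]
  refine ⟨K', hK₀0.trans hK'1, fun t ht => ?_⟩
  -- notation for the slice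
  set s : ℝ := -t with hs
  have hs0 : 0 < s := by rw [hs]; linarith
  set a : ℝ := Real.sqrt s with ha
  have ha0 : 0 < a := Real.sqrt_pos.2 hs0
  have ha_rpow : a = s ^ (1 / 2 : ℝ) := Real.sqrt_eq_rpow s
  have hmaj : ∀ x : ℝ³, ‖V₁ t x - V₂ t x‖ ≤ K₀ * s / (‖x‖ + a) ^ 3 := fun x =>
    majorant hC hK hd₁ hd₂ hfar ht x
  refine ⟨fun x => (hmaj x).trans ?_, ?_, ?_, ?_⟩
  · -- (i) with the larger constant
    exact div_le_div_of_nonneg_right (mul_le_mul_of_nonneg_right hK'1 hs0.le) (by positivity)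
  · -- (ii) L² rate |t|^{1/4}
    have hf : ∀ x : ℝ³, ‖V₁ t x - V₂ t x‖ ≤ (K₀ * s) * (‖x‖ + a) ^ (-(3 : ℝ)) := fun x => by
      rw [← div_pow_three_eq_mul_rpow (by positivity)]; exact hmaj x
    have h := eLpNorm_le_of_radial_majorant (f := fun x => V₁ t x - V₂ t x) ha0 (by positivity)
      (by norm_num : (1 : ℝ) ≤ 2) (by norm_num : (3 : ℝ) < 3 * 2) hf
    rw [ENNReal.ofReal_ofNat] at h
    refine h.trans (ENNReal.ofReal_le_ofReal ?_)
    have hexp : (K₀ * s) * a ^ (3 / 2 - 3 : ℝ) = K₀ * s ^ (1 / 4 : ℝ) := by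
      rw [ha_rpow, ← Real.rpow_mul hs0.le, mul_assoc, ← Real.rpow_one_add' hs0.le (by norm_num)]
      norm_num
    calc K₀ * s * a ^ (3 / 2 - 3 : ℝ) * c₂ = (K₀ * c₂) * s ^ (1 / 4 : ℝ) := by rw [hexp]; ring
      _ ≤ K' * s ^ (1 / 4 : ℝ) := mul_le_mul_of_nonneg_right hK'2 (Real.rpow_nonneg hs0.le _)
  · -- (iii) L^{6/5} rate |t|^{3/4}
    have hf : ∀ x : ℝ³, ‖V₁ t x - V₂ t x‖ ≤ (K₀ * s) * (‖x‖ + a) ^ (-(3 : ℝ)) := fun x => by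
      rw [← div_pow_three_eq_mul_rpow (by positivity)]; exact hmaj x
    have h := eLpNorm_le_of_radial_majorant (f := fun x => V₁ t x - V₂ t x) ha0 (by positivity)
      (by norm_num : (1 : ℝ) ≤ 6 / 5) (by norm_num : (3 : ℝ) < 3 * (6 / 5)) hf
    have h65 : ENNReal.ofReal (6 / 5 : ℝ) = (6 : ℝ≥0∞) / 5 := by
      rw [ENNReal.ofReal_div_of_pos (by norm_num : (0 : ℝ) < 5)]
      norm_num
    rw [h65] at h
    refine h.trans (ENNReal.ofReal_le_ofReal ?_)
    have hexp : (K₀ * s) * a ^ (3 / (6 / 5) - 3 : ℝ) = K₀ * s ^ (3 / 4 : ℝ) := by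
      rw [ha_rpow, ← Real.rpow_mul hs0.le, mul_assoc, ← Real.rpow_one_add' hs0.le (by norm_num)]
      norm_num
    calc K₀ * s * a ^ (3 / (6 / 5) - 3 : ℝ) * c₃ = (K₀ * c₃) * s ^ (3 / 4 : ℝ) := by rw [hexp]; ring
      _ ≤ K' * s ^ (3 / 4 : ℝ) := mul_le_mul_of_nonneg_right hK'3 (Real.rpow_nonneg hs0.le _)
  · -- (iv) gradient difference, L² rate |t|^{-1/4}
    have hf : ∀ x : ℝ³, ‖fderiv ℝ (V₁ t) x - fderiv ℝ (V₂ t) x‖ ≤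
        (L₁ + L₂) * (‖x‖ + a) ^ (-(2 : ℝ)) := fun x => by
      rw [← div_pow_two_eq_mul_rpow (by positivity)]
      calc ‖fderiv ℝ (V₁ t) x - fderiv ℝ (V₂ t) x‖ ≤ ‖fderiv ℝ (V₁ t) x‖ + ‖fderiv ℝ (V₂ t) x‖ :=
            norm_sub_le _ _
        _ ≤ L₁ / (‖x‖ + a) ^ 2 + L₂ / (‖x‖ + a) ^ 2 := add_le_add (hg₁ t ht x) (hg₂ t ht x)
        _ = (L₁ + L₂) / (‖x‖ + a) ^ 2 := by ring
    have h := eLpNorm_le_of_radial_majorant (f := fun x => fderiv ℝ (V₁ t) x - fderiv ℝ (V₂ t) x)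
      ha0 (add_nonneg hL₁ hL₂) (by norm_num : (1 : ℝ) ≤ 2) (by norm_num : (3 : ℝ) < 2 * 2) hf
    rw [ENNReal.ofReal_ofNat] at h
    refine h.trans (ENNReal.ofReal_le_ofReal ?_)
    have hexp : a ^ (3 / 2 - 2 : ℝ) = s ^ (-(1 : ℝ) / 4) := by
      rw [ha_rpow, ← Real.rpow_mul hs0.le]
      norm_num
    calc (L₁ + L₂) * a ^ (3 / 2 - 2 : ℝ) * c₄ = ((L₁ + L₂) * c₄) * s ^ (-(1 : ℝ) / 4) := by
          rw [hexp]; ring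
      _ ≤ K' * s ^ (-(1 : ℝ) / 4) := mul_le_mul_of_nonneg_right hK'4 (Real.rpow_nonneg hs0.le _)

end Refuter.Drefute.FELC.S2

end
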